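import Literature.NumberTheory.Automorphic.ArchEndoscopicChartOrbLocallyBounded    -- (α4⁰) part 2 (this seat): `exists_nhds_norm_archRH_mul_chartOrbH_le` (product positivity over ★ (α1), wall places by ★ part 1 over ★ (α2))
import Literature.NumberTheory.Rogawski1990.ArchBouazizStableFamilySlabSmooth      -- ★ p850541 (this seat): [C1b] `contDiffOn_stOrbFamH_inRegS`; brings ★ `stOrbFamH`, ★ `mem_closure_regS`, ★ `mem_inRegS_of_mem_slab`
import HarnessLib

/-!
# (I₂) AT ORDER ZERO FOR A GENERAL TEST FUNCTION: the normalised stable orbital family `stOrbFamH L νH fH S` is BOUNDED on `K ∩ InRegS S` for every compact `K`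
# — Harish-Chandra's boundedness of the normalised orbital integrals up to ALL the compact walls simultaneously (Varadarajan 1989 §6.4 Thm 22; Bouaziz 1994 §3.1 (I₂); Rogawski 1990 §4.1, §8.2)

Topic `NumberTheory/Rogawski1990`; namespace `Literature.NumberTheory.Rogawski1990`.  THEOREMS ONLY (no `def`, no instance, no axiom, no `sorry`).  Cell `pub/hodgecm-mathlib`,
crux H413 (`stmt-HodgeConjecture-24833`), line LH3 (closer stub `stub_N9`, DIRECT ROAD), organ O-L3′ conjunct (ii) pay-down for GENERAL `fH` (LH3-plan (g3) RULINGS #7 (d) ∕ #11): stage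
(α4⁰) part 3∕3 — the ORDER-ZERO instance of the `h2` of ★ `archBzSmoothBounded_stOrbFamH_of_slab_zero` for general `fH`.  Author LH3-p01 (g4).  Count-neutral.

THE MATHEMATICS.  (§1) Two generic lemmas: a function bounded near every point of a compact is bounded on it (trace on a fixed set), and a norm bound on `U ∩ V` passes to `U ∩ O` when the
function is continuous on the open `O ⊆ closure V`.  (§2) `‖R_S(flipSet T c)‖ = ‖R_S(c)‖` for `T ⊆ Sᶜ` (the flip characters are units, ★ `archRH_flipSet`).  (§3) On `RegS S` the family is
LITERALLY `R_S(c) · Σ_{T ⊆ Sᶜ} chartOrbH(flipSet T c)` (★ `stOrbFamH_of_mem_regS`), so ★ part 2 at the `2^{#Sᶜ}` base points `flipSet T c₀` gives **`exists_nhds_norm_stOrbFamH_le_of_mem_regS`**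
(continuous compactly supported `fH`).  (§4) For `fH ∈ C_c^∞(H_∞)` (★ `ArchSmooth₂`) the family is continuous on the open set `InRegS S` (★ [C1b]) in which `RegS S` is dense (★ `mem_closure_regS`):
**`exists_nhds_forall_norm_stOrbFamH_le`** (`∀ c₀, ∃ U ∈ 𝓝 c₀, ∃ B, ∀ c ∈ U ∩ InRegS S, ‖stOrbFamH L νH fH S c‖ ≤ B`), by compactness **`bddAbove_norm_stOrbFamH_image_inter_inRegS`**, and the
literal `n = 0` instance **`bddAbove_norm_iteratedFDeriv_zero_stOrbFamH_image`** of the `h2` of ★ `archBzSmoothBounded_stOrbFamH_of_slab_zero` (the slab lies in `InRegS S`).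
HONEST LABEL: HC_CM is proved only modulo the 7 printed citations (2 remaining: hLiu418 = stmt-HodgeConjecture-24832, h413 = stmt-HodgeConjecture-24833) until rung 0 closes;
this is `h2` at order `0` only — the orders `n ≥ 1` need the per-place Casimir ladders ((α3)–(α4)); the surjectivity half of L3′ is separate.

## References
* [Varadarajan1989] V. S. Varadarajan, *An Introduction to Harmonic Analysis on Semisimple Lie Groups*, Cambridge Stud. Adv. Math. 16 (1989), §6.4 Thms 22–23.
* [Bouaziz1994IntegralesOrbitales] A. Bouaziz, *Intégrales orbitales sur les algèbres de Lie réductives*, Invent. Math. 115 (1994), §3.1 (I₂) p. 579; §6.2 p. 591.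
* [Shelstad1979] D. Shelstad, *Characters and inner forms of a quasi-split group over ℝ*, Compositio Math. 39 (1979), §4 pp. 22–25.
* [Rogawski1990] J. D. Rogawski, *Automorphic Representations of Unitary Groups in Three Variables*, Ann. of Math. Stud. 123 (1990), §4.1 (4.1.1) p. 39; §8.2 pp. 119–122.
-/

set_option autoImplicit false

noncomputable section

open MeasureTheory Measure Filter Topology Set Function NumberField NumberField.InfinitePlace Matrix Complex
open Literature.NumberTheory.Automorphic Literature.NumberTheory.Automorphic.UnitaryGroup Literature.NumberTheory.Automorphic.ArchCartan
open scoped ContDiff Classical MatrixGroups Matrix ENNReal NNReal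
open scoped Matrix.Norms.Operator

local notation3 "Φ₂[" L "]" => (Matrix.of fun i j : Fin 2 => if i.val + j.val + 1 = 2 then (1 : L) else 0)
local notation3 "Φ₁[" L "]" => (Matrix.of fun i j : Fin 1 => if i.val + j.val + 1 = 1 then (1 : L) else 0)
local notation3 "𝔸[" L "]" => ↥(arch (↥(maximalRealSubfield L)) L (IsCMField.complexConj L) 2 Φ₂[L])
local notation3 "𝔹[" L "]" => ↥(arch (↥(maximalRealSubfield L)) L (IsCMField.complexConj L) 1 Φ₁[L])

/-! ## §1 Two generic lemmas: local-to-global boundedness on a compact, and a bound passes to the closure along a continuous function -/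

namespace Literature.NumberTheory.Rogawski1990

/-- A function bounded above near every point of a compact `K` (on the trace of a fixed set `A`) is bounded above on `K ∩ A`. [cite: Bouaziz1994IntegralesOrbitales, §3.1 p. 579] -/
theorem bddAbove_image_inter_of_forall_nhds {X : Type*} [TopologicalSpace X] {K A : Set X} (hK : IsCompact K) {g : X → ℝ}
    (h : ∀ x ∈ K, ∃ U ∈ 𝓝 x, BddAbove (g '' (U ∩ A))) : BddAbove (g '' (K ∩ A)) := by
  choose! U hU hB using h
  obtain ⟨t, htK, hcov⟩ := hK.elim_nhds_subcover U hU
  have hfin : BddAbove (⋃ x ∈ (t : Set X), g '' (U x ∩ A)) := (t.finite_toSet.bddAbove_biUnion).2 fun x hx => hB x (htK x hx)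
  refine hfin.mono ?_
  rintro _ ⟨y, ⟨hyK, hyA⟩, rfl⟩
  obtain ⟨x, hxt, hyU⟩ := mem_iUnion₂.1 (hcov hyK)
  exact mem_iUnion₂.2 ⟨x, hxt, mem_image_of_mem g ⟨hyU, hyA⟩⟩

/-- A norm bound on `U ∩ V` (`U` open) passes to `U ∩ O` when `f` is continuous on the open set `O ⊆ closure V`. [cite: Bouaziz1994IntegralesOrbitales, §3.1 p. 579] -/
theorem norm_le_of_continuousOn_of_subset_closure {X E : Type*} [TopologicalSpace X] [SeminormedAddCommGroup E] {f : X → E} {O V U : Set X} {B : ℝ}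
    (hO : IsOpen O) (hf : ContinuousOn f O) (hV : O ⊆ closure V) (hU : IsOpen U) (hB : ∀ x ∈ U ∩ V, ‖f x‖ ≤ B) : ∀ x ∈ U ∩ O, ‖f x‖ ≤ B := by
  rintro x ⟨hxU, hxO⟩
  have hcont : ContinuousAt f x := hf.continuousAt (hO.mem_nhds hxO)
  have hmem : x ∈ closure (U ∩ V) := by
    rw [mem_closure_iff_nhds]
    intro t ht
    obtain ⟨y, ⟨hyt, hyU⟩, hyV⟩ := mem_closure_iff_nhds.1 (hV hxO) (t ∩ U) (inter_mem ht (hU.mem_nhds hxU))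
    exact ⟨y, hyt, hyU, hyV⟩
  haveI : (𝓝[U ∩ V] x).NeBot := mem_closure_iff_nhdsWithin_neBot.1 hmem
  have ht : Tendsto (fun y => ‖f y‖) (𝓝[U ∩ V] x) (𝓝 ‖f x‖) := (hcont.tendsto.mono_left nhdsWithin_le_nhds).norm
  exact le_of_tendsto ht (eventually_nhdsWithin_of_forall fun y hy => hB y hy)

/-! ## §2 The flips do not change `‖R_S‖` -/

/-- **The flips do not change `‖R_S‖`**: `‖archRH S (flipSet T c)‖ = ‖archRH S c‖` for `T ⊆ Sᶜ` (the flip characters `−e^{i(θ₀−θ₂)}` are units, ★ `archRH_flipSet`).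
[cite: Shelstad1979, §4 p. 23] -/
theorem norm_archRH_flipSet {W : Type*} [Fintype W] [DecidableEq W] (S T : Finset W) (hT : ∀ w ∈ T, w ∉ S) (c : W → Fin 3 → ℝ) :
    ‖archRH S (flipSet T c)‖ = ‖archRH S c‖ := by
  rw [archRH_flipSet S T hT c, norm_mul, norm_prod, Finset.prod_eq_one fun w _ => by rw [norm_neg, Circle.norm_coe], one_mul]

/-! ## §3–§4 THE HEADS: `stOrbFamH L νH fH S` is locally bounded on `RegS S` (continuous `fH`), on `InRegS S` (`fH ∈ C_c^∞`), and bounded on `K ∩ InRegS S` -/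

section RegS

variable (L : Type) [Field L] [NumberField L] [IsCMField L] (S : Finset {w : InfinitePlace L // IsComplex w})
  [MeasurableSpace 𝔸[L]] [BorelSpace 𝔸[L]] [MeasurableSpace 𝔹[L]] [BorelSpace 𝔹[L]]
  (νH : Measure (𝔸[L] × 𝔹[L])) [νH.IsHaarMeasure] [νH.IsMulRightInvariant]

/-- **THE STABLE ORBITAL FAMILY IS LOCALLY BOUNDED ON THE REGULAR SET, UP TO ALL THE WALLS**: for continuous compactly supported `fH`, a Haar measure `νH`, every `S` and every base point `c₀`
there are `U ∈ 𝓝 c₀` and `B` with `‖stOrbFamH L νH fH S c‖ ≤ B` for `c ∈ U ∩ RegS S`.  On `RegS S` the family is `R_S(c) · Σ_{T ⊆ Sᶜ} chartOrbH(flipSet T c)` (★ `stOrbFamH_of_mem_regS`),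
`‖R_S(c)‖ = ‖R_S(flipSet T c)‖` (§2), and ★ part 2 bounds each `‖R_S · chartOrbH‖` near the `2^{#Sᶜ}` base points `flipSet T c₀`. [cite: Varadarajan1989, §6.4 Thm 22] [cite: Shelstad1979, §4 pp. 23–24]
[cite: Bouaziz1994IntegralesOrbitales, §3.1 (I₂) p. 579] [cite: Rogawski1990, §4.1 (4.1.1) p. 39] -/
theorem exists_nhds_norm_stOrbFamH_le_of_mem_regS (fH : 𝔸[L] × 𝔹[L] → ℂ) (hf : Continuous fH) (hfc : HasCompactSupport fH)
    (c₀ : {w : InfinitePlace L // IsComplex w} → Fin 3 → ℝ) :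
    ∃ U ∈ 𝓝 c₀, ∃ B : ℝ, ∀ c ∈ U, c ∈ RegS S → ‖stOrbFamH L νH fH S c‖ ≤ B := by
  choose U hU B hB using fun T : Finset {w : InfinitePlace L // IsComplex w} => exists_nhds_norm_archRH_mul_chartOrbH_le L S νH fH hf hfc (flipSet T c₀)
  refine ⟨⋂ T ∈ (Finset.univ \ S).powerset, flipSet T ⁻¹' U T, (Filter.biInter_finset_mem _).2 fun T _ =>
    (contDiff_flipSet T).continuous.continuousAt.preimage_mem_nhds (hU T), ∑ T ∈ (Finset.univ \ S).powerset, B T, fun c hcU hc => ?_⟩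
  rw [stOrbFamH_of_mem_regS L νH fH S hc, Finset.mul_sum]
  refine (norm_sum_le _ _).trans (Finset.sum_le_sum fun T hT => ?_)
  have hTS : ∀ w ∈ T, w ∉ S := not_mem_of_mem_powerset_sdiff hT
  rw [norm_mul, ← norm_archRH_flipSet S T hTS c, ← norm_mul]
  exact hB T (flipSet T c) (mem_iInter₂.1 hcU T hT) ((flipSet_mem_regS_iff S hTS c).2 hc)

end RegS

section Heads

variable (L : Type) [Field L] [NumberField L] [IsCMField L]
  [iH : MeasurableSpace (𝔸[L] × 𝔹[L])] [BorelSpace (𝔸[L] × 𝔹[L])]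
  (νH : Measure (𝔸[L] × 𝔹[L])) [νH.IsHaarMeasure] [νH.IsMulRightInvariant]

/-- **(I₂) AT ORDER ZERO, LOCAL FORM**: for `fH ∈ C_c^∞(H_∞)` (★ `ArchSmooth₂`), a Haar measure `νH`, every `S` and every `c₀` there are `U ∈ 𝓝 c₀` and `B` with `‖stOrbFamH L νH fH S c‖ ≤ B`
for all `c ∈ U ∩ InRegS S` — Harish-Chandra's boundedness of the normalised stable orbital integrals up to all the compact walls at once.  From §3 on `U ∩ RegS S`; the family is
continuous on the open set `InRegS S` (★ [C1b] `contDiffOn_stOrbFamH_inRegS`) and `RegS S` is dense (★ `mem_closure_regS`). [cite: Varadarajan1989, §6.4 Thm 22]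
[cite: Bouaziz1994IntegralesOrbitales, §3.1 (I₂) p. 579; §6.2 p. 591] [cite: Shelstad1979, §4 p. 24] -/
theorem exists_nhds_forall_norm_stOrbFamH_le {fH : 𝔸[L] × 𝔹[L] → ℂ} (hfH : ArchSmooth₂ L fH) (S : Finset {w : InfinitePlace L // IsComplex w})
    (c₀ : {w : InfinitePlace L // IsComplex w} → Fin 3 → ℝ) :
    ∃ U ∈ 𝓝 c₀, ∃ B : ℝ, ∀ c ∈ U ∩ InRegS S, ‖stOrbFamH L νH fH S c‖ ≤ B := by
  -- pass to the Borel structures of the factors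
  letI mA : MeasurableSpace 𝔸[L] := borel _
  haveI : BorelSpace 𝔸[L] := ⟨rfl⟩
  letI mB : MeasurableSpace 𝔹[L] := borel _
  haveI : BorelSpace 𝔹[L] := ⟨rfl⟩
  have hiH : iH = Prod.instMeasurableSpace :=
    (‹BorelSpace (𝔸[L] × 𝔹[L])›.measurable_eq).trans (Prod.borelSpace (α := 𝔸[L]) (β := 𝔹[L])).measurable_eq.symm
  subst hiH
  obtain ⟨U, hU, B, hB⟩ := exists_nhds_norm_stOrbFamH_le_of_mem_regS L S νH fH hfH.continuous (ArchSmooth₂.hasCompactSupport L hfH) c₀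
  obtain ⟨V, hVU, hV, hcV⟩ := mem_nhds_iff.1 hU
  exact ⟨V, hV.mem_nhds hcV, B, norm_le_of_continuousOn_of_subset_closure (isOpen_inRegS S) (contDiffOn_stOrbFamH_inRegS L νH hfH S).continuousOn
    (fun c _ => mem_closure_regS S c) hV fun c hc => hB c (hVU hc.1) hc.2⟩

/-- **(I₂) AT ORDER ZERO: `stOrbFamH L νH fH S` IS BOUNDED ON `K ∩ InRegS S` FOR EVERY COMPACT `K`** (`fH ∈ C_c^∞`, `νH` Haar). [cite: Varadarajan1989, §6.4 Thm 22]
[cite: Bouaziz1994IntegralesOrbitales, §3.1 (I₂) p. 579] -/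
theorem bddAbove_norm_stOrbFamH_image_inter_inRegS {fH : 𝔸[L] × 𝔹[L] → ℂ} (hfH : ArchSmooth₂ L fH) (S : Finset {w : InfinitePlace L // IsComplex w})
    {K : Set ({w : InfinitePlace L // IsComplex w} → Fin 3 → ℝ)} (hK : IsCompact K) :
    BddAbove ((fun c => ‖stOrbFamH L νH fH S c‖) '' (K ∩ InRegS S)) := by
  refine bddAbove_image_inter_of_forall_nhds hK fun c₀ _ => ?_
  obtain ⟨U, hU, B, hB⟩ := exists_nhds_forall_norm_stOrbFamH_le L νH hfH S c₀
  exact ⟨U, hU, B, forall_mem_image.2 hB⟩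

/-- **THE `n = 0` INSTANCE OF THE `h2` OF ★ `archBzSmoothBounded_stOrbFamH_of_slab_zero`, FOR A GENERAL TEST FUNCTION**: the `0`-jet of `stOrbFamH L νH fH S` is bounded on
`K ∩ {0 < θ_{w,0} − θ_{w,2} < 2π (w ∉ S)}` for every compact `K` (the slab lies in `InRegS S`, ★ `mem_inRegS_of_mem_slab`). [cite: Bouaziz1994IntegralesOrbitales, §3.1 (I₂) p. 579; §6.2 p. 591]
[cite: Varadarajan1989, §6.4 Thm 22] -/
theorem bddAbove_norm_iteratedFDeriv_zero_stOrbFamH_image {fH : 𝔸[L] × 𝔹[L] → ℂ} (hfH : ArchSmooth₂ L fH) (S : Finset {w : InfinitePlace L // IsComplex w})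
    {K : Set ({w : InfinitePlace L // IsComplex w} → Fin 3 → ℝ)} (hK : IsCompact K) :
    BddAbove ((fun c => ‖iteratedFDeriv ℝ 0 (stOrbFamH L νH fH S) c‖) '' (K ∩ {c | ∀ w, w ∉ S → 0 < c w 0 - c w 2 ∧ c w 0 - c w 2 < 2 * Real.pi})) := by
  have h0 : (fun c => ‖iteratedFDeriv ℝ 0 (stOrbFamH L νH fH S) c‖) = fun c => ‖stOrbFamH L νH fH S c‖ := funext fun c => norm_iteratedFDeriv_zero
  rw [h0]
  refine (bddAbove_norm_stOrbFamH_image_inter_inRegS L νH hfH S hK).mono (image_mono (inter_subset_inter_right K fun c hc => ?_))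
  refine mem_inRegS_of_mem_slab S 0 fun w hw => ?_
  have h := hc w hw
  simp only [Pi.zero_apply, Int.cast_zero, mul_zero, zero_add, mul_one]
  exact h

end Heads

end Literature.NumberTheory.Rogawski1990

end
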